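import Mathlib
import Summits.ValiantsHypothesis.ValiantsHypothesis.Theorems.LiouvilleSarnakLiouvilleCutRankMultiplicativeBarrier
import Summits.ValiantsHypothesis.ValiantsHypothesis.Theorems.LiouvilleSarnakLiouvilleCutRankRelaxedModelSmallBudgets

/-!
# Route LiouvilleSarnak — crux `LiouvilleCutRank` (stmt-ValiantsHypothesis-14775): the third conductor-`8` twin
# (`χ₄χ₈`) and the relaxed-model budgets it kills

Companion of `…MultiplicativeBarrier` (`χ₄`-twin: `f(3) = f(7) = -1`) and `…ModEightBarrier` (`χ₈`-twin:
`f(3) = f(5) = -1`): the `χ₄χ₈`-TWIN `f(2^v M) = (-1)^v χ₄χ₈(M)` (`χ₄χ₈(M) = -1` iff `M ≡ 5, 7 (mod 8)`) is completely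
multiplicative, `±1`-valued, with `f(2) = f(5) = f(7) = -1`, `f(3) = 1` — it agrees with `λ` at every prime
`p ≡ 5, 7 (mod 8)` — and its aligned cut matrices have rank `≤ 6` at every level `n ≥ 3`
(★ `exists_completelyMultiplicative_chi4chi8_alignedRank_le_six`).  Consequently the relaxed-model hypothesis `S_D`
of `…RelaxedModelBridge` is FALSE for every `D ⊆ {2} ∪ {primes ≡ 5, 7 (mod 8)}`
(★ `not_relaxedHypothesis_of_mod8'`, instance `not_relaxedHypothesis_two_five_seven`).  With
`…RelaxedModelSmallBudgets` this completes the kernel-checked classification: `S_D` fails whenever the odd primes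
of `D` avoid one of the three classes `3, 5, 7 (mod 8)` and contain no prime `≡ 1 (mod 8)`; the first initial
segment of the primes that survives is `{2, 3, 5, 7}`.  Honest framing: a barrier lemma; `LiouvilleCutRank`,
`DigitalBilinearLiouville`, `AlgebraicSarnak` stay OPEN; nothing bears on `VP ≠ VNP`.  No definitions.
-/

set_option linter.dupNamespace false

noncomputable section

namespace Summit.ValiantsHypothesis.ValiantsHypothesis.Theorems.LiouvilleSarnakLiouvilleCutRank.ModEightBarrierTwo

open Finset

open Summit.ValiantsHypothesis.ValiantsHypothesis.Theorems.LiouvilleSarnakLiouvilleCutRank.OneBlock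
  (rank_le_card_image_row)
open Summit.ValiantsHypothesis.ValiantsHypothesis.Theorems.LiouvilleSarnakLiouvilleCutRank.MultiplicativeBarrier
  (exists_eq_two_pow_mul_odd)

/-! ### §1 The witness `f(2^v M) = (-1)^v χ₈(M)` on numbers `2^v · odd` -/

/-- The witness evaluated at `2^v · M`, `M` odd: `(-1)^v · χ₄χ₈(M)` with `χ₄χ₈(M) = -1` iff `M ≡ 5, 7 (mod 8)`.
[folklore] -/
theorem witness_two_pow_mul_odd (v M : ℕ) (hM : M % 2 = 1) :
    (fun m : ℕ => (-1 : ℤ) ^ (m.factorization 2) *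
        (if (m / 2 ^ (m.factorization 2)) % 8 = 5 ∨ (m / 2 ^ (m.factorization 2)) % 8 = 7 then -1 else 1))
        (2 ^ v * M) =
      (-1 : ℤ) ^ v * (if M % 8 = 5 ∨ M % 8 = 7 then -1 else 1) := by
  have hM0 : M ≠ 0 := by intro h; simp [h] at hM
  have hfac : (2 ^ v * M).factorization 2 = v := by
    rw [Nat.factorization_mul (pow_ne_zero _ two_ne_zero) hM0, Finsupp.add_apply,
      Nat.Prime.factorization_pow Nat.prime_two, Finsupp.single_eq_same,
      Nat.factorization_eq_zero_of_not_dvd (fun h => by omega), add_zero]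
  simp only [hfac, Nat.mul_div_cancel_left M (Nat.two_pow_pos v)]

/-- For odd `M₁, M₂`: `χ₄χ₈(M₁ M₂) = χ₄χ₈(M₁) χ₄χ₈(M₂)` in the `±1` form (the residues `5, 7 (mod 8)` form a coset
of the subgroup `{1, 3}` of `(ℤ/8)ˣ`). [folklore] -/
theorem sign_mul_of_odd (M₁ M₂ : ℕ) (h₁ : M₁ % 2 = 1) (h₂ : M₂ % 2 = 1) :
    (if (M₁ * M₂) % 8 = 5 ∨ (M₁ * M₂) % 8 = 7 then (-1 : ℤ) else 1) =
      (if M₁ % 8 = 5 ∨ M₁ % 8 = 7 then (-1 : ℤ) else 1) *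
        (if M₂ % 8 = 5 ∨ M₂ % 8 = 7 then (-1 : ℤ) else 1) := by
  have hm : (M₁ * M₂) % 8 = ((M₁ % 8) * (M₂ % 8)) % 8 := Nat.mul_mod _ _ _
  have h1' : M₁ % 8 = 1 ∨ M₁ % 8 = 3 ∨ M₁ % 8 = 5 ∨ M₁ % 8 = 7 := by omega
  have h2' : M₂ % 8 = 1 ∨ M₂ % 8 = 3 ∨ M₂ % 8 = 5 ∨ M₂ % 8 = 7 := by omega
  rcases h1' with ha | ha | ha | ha <;> rcases h2' with hb | hb | hb | hb <;> simp [hm, ha, hb]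

/-! ### §2 The barrier -/

/-- ★ **The `χ₄χ₈`-twin.**  There is a completely multiplicative `f : ℕ → ℤ` with values in `{1, -1}` on the
positive integers, with `f(2) = f(5) = f(7) = -1`, `f(3) = 1`, and `f(m) = -1` for every `m ≡ 5, 7 (mod 8)` (so
`f(p) = λ(p)` for every prime `p ≡ 5, 7 (mod 8)`), such that for every `n ≥ 3` the aligned cut matrix
`(f(a + 2^n b + 1))_{a,b<2^n}` has rank `≤ 6`.  Witness: `f(2^v M) = (-1)^v χ₄χ₈(M)` (`M` odd). [folklore] -/
theorem exists_completelyMultiplicative_chi4chi8_alignedRank_le_six :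
    ∃ f : ℕ → ℤ, (∀ m, 1 ≤ m → f m = 1 ∨ f m = -1) ∧ (∀ a b, 1 ≤ a → 1 ≤ b → f (a * b) = f a * f b) ∧
      f 2 = -1 ∧ f 3 = 1 ∧ f 5 = -1 ∧ f 7 = -1 ∧ (∀ m, m % 8 = 5 ∨ m % 8 = 7 → f m = -1) ∧
      ∀ n, 3 ≤ n → (Matrix.of fun a b : Fin (2 ^ n) =>
        ((f ((a : ℕ) + 2 ^ n * (b : ℕ) + 1) : ℤ) : ℂ)).rank ≤ 6 := by
  classical
  let f : ℕ → ℤ := fun m =>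
    (-1 : ℤ) ^ (m.factorization 2) *
      (if (m / 2 ^ (m.factorization 2)) % 8 = 5 ∨ (m / 2 ^ (m.factorization 2)) % 8 = 7 then -1 else 1)
  have hf : ∀ v M : ℕ, M % 2 = 1 →
      f (2 ^ v * M) = (-1 : ℤ) ^ v * (if M % 8 = 5 ∨ M % 8 = 7 then -1 else 1) :=
    fun v M hM => witness_two_pow_mul_odd v M hM
  have hodd1 : ∀ m, m % 2 = 1 → f m = (if m % 8 = 5 ∨ m % 8 = 7 then -1 else 1) := by
    intro m hm
    have := hf 0 m hm
    simpa using this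
  refine ⟨f, fun m hm => ?_, fun a b ha hb => ?_, ?_, ?_, ?_, ?_, fun m hm => ?_, fun n hn => ?_⟩
  · -- values `±1`
    obtain ⟨v, M, hM, rfl⟩ := exists_eq_two_pow_mul_odd m (by omega)
    rw [hf v M hM]
    rcases neg_one_pow_eq_or ℤ v with h | h <;> rw [h] <;> split_ifs <;> simp
  · -- complete multiplicativity
    obtain ⟨v, M, hM, rfl⟩ := exists_eq_two_pow_mul_odd a (by omega)
    obtain ⟨v', M', hM', rfl⟩ := exists_eq_two_pow_mul_odd b (by omega)
    have hMM : (M * M') % 2 = 1 := by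
      have := Nat.mul_mod M M' 2; rw [hM, hM'] at this; simpa using this
    rw [show 2 ^ v * M * (2 ^ v' * M') = 2 ^ (v + v') * (M * M') by ring, hf _ _ hMM, hf v M hM,
      hf v' M' hM', sign_mul_of_odd M M' hM hM', pow_add]
    ring
  · -- `f 2 = -1`
    have := hf 1 1 (by norm_num)
    simpa using this
  · -- `f 3 = 1`
    rw [hodd1 3 (by norm_num)]; norm_num
  · -- `f 5 = -1`
    rw [hodd1 5 (by norm_num)]; norm_num
  · -- `f 7 = -1`
    rw [hodd1 7 (by norm_num)]; norm_num
  · -- `f m = -1` for `m ≡ ±3 (mod 8)`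
    have h1 : m % 2 = 1 := by omega
    rw [hodd1 m h1, if_pos hm]
  · -- the aligned matrix has at most six distinct rows
    set A : Matrix (Fin (2 ^ n)) (Fin (2 ^ n)) ℂ := Matrix.of fun a b : Fin (2 ^ n) =>
        ((f ((a : ℕ) + 2 ^ n * (b : ℕ) + 1) : ℤ) : ℂ) with hA
    -- generic rows are constant
    have hconst : ∀ a : Fin (2 ^ n), ((a : ℕ) + 1).factorization 2 + 3 ≤ n →
        A a = fun _ => ((f ((a : ℕ) + 1) : ℤ) : ℂ) := by
      intro a hv
      funext b
      simp only [hA, Matrix.of_apply]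
      congr 1
      obtain ⟨v, M, hM, hm⟩ := exists_eq_two_pow_mul_odd ((a : ℕ) + 1) (Nat.succ_ne_zero _)
      have hvf : ((a : ℕ) + 1).factorization 2 = v := by
        rw [hm, Nat.factorization_mul (pow_ne_zero _ two_ne_zero) (by omega), Finsupp.add_apply,
          Nat.Prime.factorization_pow Nat.prime_two, Finsupp.single_eq_same,
          Nat.factorization_eq_zero_of_not_dvd (fun h => by omega), add_zero]
      rw [hvf] at hv
      -- `a + 1 + 2^n b = 2^v (M + 8K)` with `K = 2^(n-v-3) b`: odd and `≡ M (mod 8)`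
      have h2 : 2 ^ n = 2 ^ v * (2 ^ (n - v - 3) * 8) := by
        rw [show (8 : ℕ) = 2 ^ 3 by norm_num, ← pow_add, ← pow_add]; congr 1; omega
      have h3 : 2 ^ n * (b : ℕ) = 2 ^ v * (2 ^ (n - v - 3) * 8) * (b : ℕ) := by rw [← h2]
      set K : ℕ := 2 ^ (n - v - 3) * (b : ℕ) with hK
      have hsplit : (a : ℕ) + 2 ^ n * (b : ℕ) + 1 = 2 ^ v * (M + 8 * K) := by
        calc (a : ℕ) + 2 ^ n * (b : ℕ) + 1 = ((a : ℕ) + 1) + 2 ^ n * (b : ℕ) := by ring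
          _ = 2 ^ v * M + 2 ^ v * (2 ^ (n - v - 3) * 8) * (b : ℕ) := by rw [hm, h3]
          _ = 2 ^ v * (M + 8 * K) := by rw [hK]; ring
      have hodd : (M + 8 * K) % 2 = 1 := by omega
      have hmod : (M + 8 * K) % 8 = M % 8 := by omega
      rw [hsplit, hf _ _ hodd, hm, hf v M hM, hmod]
    -- the exceptional rows: `2^(n-2) ∣ a + 1`, i.e. `a + 1 = k · 2^(n-2)` with `1 ≤ k ≤ 4`
    have hexc : ∀ a : Fin (2 ^ n), ¬ ((a : ℕ) + 1).factorization 2 + 3 ≤ n →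
        (a : ℕ) + 1 = 2 ^ (n - 2) ∨ (a : ℕ) + 1 = 2 * 2 ^ (n - 2) ∨ (a : ℕ) + 1 = 3 * 2 ^ (n - 2) ∨
          (a : ℕ) + 1 = 4 * 2 ^ (n - 2) := by
      intro a hv
      have hdvd : 2 ^ (n - 2) ∣ (a : ℕ) + 1 := by
        have h1 : 2 ^ (((a : ℕ) + 1).factorization 2) ∣ (a : ℕ) + 1 := Nat.ordProj_dvd _ _
        exact dvd_trans (pow_dvd_pow 2 (by omega)) h1
      obtain ⟨k, hk⟩ := hdvd
      have ha : (a : ℕ) < 2 ^ n := a.isLt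
      have h2n : 2 ^ n = 4 * 2 ^ (n - 2) := by
        rw [show (4 : ℕ) = 2 ^ 2 by norm_num, ← pow_add]; congr 1; omega
      have hc : 1 ≤ 2 ^ (n - 2) := Nat.one_le_two_pow
      have hkpos : 1 ≤ k := by
        rcases Nat.eq_zero_or_pos k with h0 | h0
        · simp [h0] at hk
        · exact h0
      have hk4 : k ≤ 4 := by
        by_contra h5
        have h5' : 5 ≤ k := by omega
        have : 2 ^ (n - 2) * 5 ≤ 2 ^ (n - 2) * k := Nat.mul_le_mul_left _ h5'
        omega
      interval_cases k
      · left; omega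
      · right; left; omega
      · right; right; left; omega
      · right; right; right; omega
    have hlt : ∀ k : ℕ, 1 ≤ k → k ≤ 4 → k * 2 ^ (n - 2) - 1 < 2 ^ n := by
      intro k hk1 hk4
      have h2n : 2 ^ n = 4 * 2 ^ (n - 2) := by
        rw [show (4 : ℕ) = 2 ^ 2 by norm_num, ← pow_add]; congr 1; omega
      have : k * 2 ^ (n - 2) ≤ 4 * 2 ^ (n - 2) := Nat.mul_le_mul_right _ hk4
      have : 1 ≤ 2 ^ (n - 2) := Nat.one_le_two_pow
      omega
    set a₁ : Fin (2 ^ n) := ⟨1 * 2 ^ (n - 2) - 1, hlt 1 le_rfl (by norm_num)⟩ with ha₁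
    set a₂ : Fin (2 ^ n) := ⟨2 * 2 ^ (n - 2) - 1, hlt 2 (by norm_num) (by norm_num)⟩ with ha₂
    set a₃ : Fin (2 ^ n) := ⟨3 * 2 ^ (n - 2) - 1, hlt 3 (by norm_num) (by norm_num)⟩ with ha₃
    set a₄ : Fin (2 ^ n) := ⟨4 * 2 ^ (n - 2) - 1, hlt 4 (by norm_num) le_rfl⟩ with ha₄
    have hpos : 1 ≤ 2 ^ (n - 2) := Nat.one_le_two_pow
    have himage : (Finset.univ.image fun a : Fin (2 ^ n) => A a) ⊆
        {(fun _ => (1 : ℂ)), (fun _ => (-1 : ℂ)), A a₁, A a₂, A a₃, A a₄} := by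
      intro x hx
      rw [Finset.mem_image] at hx
      obtain ⟨a, -, rfl⟩ := hx
      simp only [Finset.mem_insert, Finset.mem_singleton]
      by_cases hv : ((a : ℕ) + 1).factorization 2 + 3 ≤ n
      · rw [hconst a hv]
        obtain ⟨v, M, hM, hm⟩ := exists_eq_two_pow_mul_odd ((a : ℕ) + 1) (Nat.succ_ne_zero _)
        rw [hm, hf v M hM]
        rcases neg_one_pow_eq_or ℤ v with h | h <;> rw [h] <;> split_ifs <;> simp
      · rcases hexc a hv with h | h | h | h
        · right; right; left
          have : a = a₁ := by rw [ha₁]; ext; simp; omega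
          rw [this]
        · right; right; right; left
          have : a = a₂ := by rw [ha₂]; ext; simp; omega
          rw [this]
        · right; right; right; right; left
          have : a = a₃ := by rw [ha₃]; ext; simp; omega
          rw [this]
        · right; right; right; right; right
          have : a = a₄ := by rw [ha₄]; ext; simp; omega
          rw [this]
    calc A.rank ≤ (Finset.univ.image fun a : Fin (2 ^ n) => A a).card := rank_le_card_image_row A
      _ ≤ ({(fun _ => (1 : ℂ)), (fun _ => (-1 : ℂ)), A a₁, A a₂, A a₃, A a₄} :
            Finset (Fin (2 ^ n) → ℂ)).card := Finset.card_le_card himage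
      _ ≤ 6 := by
          refine (Finset.card_insert_le _ _).trans ?_
          refine (Nat.succ_le_succ (Finset.card_insert_le _ _)).trans ?_
          refine (Nat.succ_le_succ (Nat.succ_le_succ (Finset.card_insert_le _ _))).trans ?_
          refine (Nat.succ_le_succ (Nat.succ_le_succ (Nat.succ_le_succ
            (Finset.card_insert_le _ _)))).trans ?_
          refine (Nat.succ_le_succ (Nat.succ_le_succ (Nat.succ_le_succ (Nat.succ_le_succ
            (Finset.card_insert_le _ _))))).trans ?_
          simp

/-! ### §3 The relaxed-model budgets killed by the `χ₄χ₈`-twin -/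

open ArithmeticFunction in
open Summit.ValiantsHypothesis.ValiantsHypothesis.Theorems.LiouvilleSarnakLiouvilleCutRank.RelaxedModelSmallBudgets
  (liouville_prime card_image_rows_alignedCut_le) in
/-- ★ **`S_D` is false for budgets inside the `χ₄χ₈` pattern.**  If every `d ∈ D` is `2` or a prime
`≡ 5, 7 (mod 8)`, the relaxed-model hypothesis `S_D` of `…RelaxedModelBridge` fails. [this file] -/
theorem not_relaxedHypothesis_of_mod8' (D : Finset ℕ)
    (hD : ∀ d ∈ D, d = 2 ∨ (d.Prime ∧ (d % 8 = 5 ∨ d % 8 = 7))) :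
    ¬ (∀ W : ℕ, ∃ n : ℕ, ∀ g : ℕ → ℤ, (∀ m, 1 ≤ m → m ≤ 4 ^ n → g m = 1 ∨ g m = -1) →
      (∀ d ∈ D, ∀ m, 1 ≤ m → d * m ≤ 4 ^ n → g (d * m) = liouville d * g m) →
      ∀ π : Fin n ⊕ Fin n ≃ Fin (2 * n),
        2 ^ W ≤ ((Finset.univ : Finset (Fin n → Bool)).image (fun r c : Fin n → Bool =>
          g (Nat.ofBits (fun j : Fin (2 * n) => Sum.elim r c (π.symm j)) + 1))).card) := by
  intro h
  obtain ⟨f, hf1, hfmul, hf2, -, -, -, hfmod, hfrank⟩ :=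
    exists_completelyMultiplicative_chi4chi8_alignedRank_le_six
  have hfD : ∀ d ∈ D, f d = liouville d := by
    intro d hd
    rcases hD d hd with rfl | ⟨hp, hmod⟩
    · rw [hf2, liouville_prime Nat.prime_two]
    · rw [hfmod d hmod, liouville_prime hp]
  obtain ⟨n, hn⟩ := h 7
  have hle := hn f (fun m hm _ => hf1 m hm)
    (fun d hd m hm _ => by
      have h1d : 1 ≤ d := by
        rcases hD d hd with rfl | ⟨hp, -⟩
        · norm_num
        · exact hp.one_lt.le
      rw [hfmul d m h1d hm, hfD d hd])
    (finSumFinEquiv.trans (finCongr (two_mul n).symm))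
  by_cases hn3 : 3 ≤ n
  · have h1 := card_image_rows_alignedCut_le n f hf1
    have h2 : 2 ^ (Matrix.of fun a b : Fin (2 ^ n) =>
        ((f ((a : ℕ) + 2 ^ n * (b : ℕ) + 1) : ℤ) : ℂ)).rank ≤ 2 ^ 6 :=
      Nat.pow_le_pow_right (by norm_num) (hfrank n hn3)
    have : (2 : ℕ) ^ 7 ≤ 2 ^ 6 := hle.trans (h1.trans h2)
    norm_num at this
  · have h1 : ((Finset.univ : Finset (Fin n → Bool)).image (fun r c : Fin n → Bool =>
        f (Nat.ofBits (fun j : Fin (2 * n) =>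
          Sum.elim r c ((finSumFinEquiv.trans (finCongr (two_mul n).symm)).symm j)) + 1))).card ≤
        2 ^ n := by
      refine (Finset.card_image_le).trans ?_
      rw [Finset.card_univ, Fintype.card_fun, Fintype.card_bool, Fintype.card_fin]
    have h2 : 2 ^ n ≤ 2 ^ 2 := Nat.pow_le_pow_right (by norm_num) (by omega)
    have : (2 : ℕ) ^ 7 ≤ 2 ^ 2 := hle.trans (h1.trans h2)
    norm_num at this

open ArithmeticFunction in
/-- The instance `D = {2, 5, 7}`. [this file] -/
theorem not_relaxedHypothesis_two_five_seven :
    ¬ (∀ W : ℕ, ∃ n : ℕ, ∀ g : ℕ → ℤ, (∀ m, 1 ≤ m → m ≤ 4 ^ n → g m = 1 ∨ g m = -1) →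
      (∀ d ∈ ({2, 5, 7} : Finset ℕ), ∀ m, 1 ≤ m → d * m ≤ 4 ^ n → g (d * m) = liouville d * g m) →
      ∀ π : Fin n ⊕ Fin n ≃ Fin (2 * n),
        2 ^ W ≤ ((Finset.univ : Finset (Fin n → Bool)).image (fun r c : Fin n → Bool =>
          g (Nat.ofBits (fun j : Fin (2 * n) => Sum.elim r c (π.symm j)) + 1))).card) :=
  not_relaxedHypothesis_of_mod8' {2, 5, 7} (by
    intro d hd
    simp only [Finset.mem_insert, Finset.mem_singleton] at hd
    rcases hd with rfl | rfl | rfl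
    · left; rfl
    · right; exact ⟨Nat.prime_five, by norm_num⟩
    · right; exact ⟨by norm_num, by norm_num⟩)

end Summit.ValiantsHypothesis.ValiantsHypothesis.Theorems.LiouvilleSarnakLiouvilleCutRank.ModEightBarrierTwo
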